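import Summits.Ventures.PercRepro.FaceGrouping
import Summits.Ventures.PercRepro.ColumnSum

/-!
# PercRepro — the `k = 3` crossing family: Lemma B at `k = 3` and the classwise route to C-004 (typer-2)

The lead's testbed (INBOX 2026-08-22T02:53:06Z): the per-class Lemma B at `k = 3` — `⊤ = abc`, the
three two-block partitions `ab|c, ac|b, bc|a` as the crossing cells, `⊥ = a|b|c` — is the class form of
C-004 (Gladkov's pair-sum), whose known proofs are global. With the family machinery of
`LemmaBAbstract.lean` / `FaceGrouping.lean`:

* `cross3` is a crossing family (`cross3_isCrossingFamily`);
* **`LemmaB3Abstract := LemmaBFamily cross3`**; `UFL3` implies it (`LemmaB3Abstract_of_UFL3`) —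
  the SAME set lemma UFL3 drives both `k = 3` and `k = 4`;
* `twoCopy_crossKernel_eq` (generic): the two-copy sum of a family kernel is
  `2·μ(⊤)μ(⊥) − Σ_{i≠j} μ(x_i)μ(x_j)`;
* **`C004abstract`** (any monotone map into `Part(3)` under a product measure) and the chain
  **`C004abstract_of_LemmaB3Abstract`**, **`C004_of_C004abstract`**, **`C004_of_LemmaB3Abstract`**,
  **`C004_of_UFL3`** — a classwise proof route for Gladkov's Cor 4.2.
-/

namespace PercRepro

open Finset

/-! ### The three two-block partitions of three indices -/

/-- The three two-block partitions of three indices: `ab|c`, `ac|b`, `bc|a` (engine rows `001`,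
`010`, `011`). -/
def cross3 : Fin 3 → Setoid (Fin 3) :=
  ![Setoid.ker ![0, 0, 1], Setoid.ker ![0, 1, 0], Setoid.ker ![0, 1, 1]]

/-- Membership in `cross3 i`, read off the labels. -/
theorem cross3_rel (i : Fin 3) (a b : Fin 3) :
    cross3 i a b ↔ (![![0, 0, 1], ![0, 1, 0], ![0, 1, 1]] i : Fin 3 → ℕ) a =
      ![![0, 0, 1], ![0, 1, 0], ![0, 1, 1]] i b := by
  fin_cases i <;> rfl

/-- The three partitions are distinct. -/
theorem cross3_injective : Function.Injective cross3 := by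
  intro i j h
  have h01 : cross3 i 0 1 ↔ cross3 j 0 1 := by rw [h]
  have h02 : cross3 i 0 2 ↔ cross3 j 0 2 := by rw [h]
  rw [cross3_rel, cross3_rel] at h01 h02
  fin_cases i <;> fin_cases j <;> simp at h01 h02 ⊢

/-- `cross3 i` is not the one-block partition (shared by p3/LemmaB3 and p6/AntipodalSMC; the
lemma lives with the definition). -/
theorem cross3_ne_top (i : Fin 3) : cross3 i ≠ ⊤ := by
  intro h
  have h1 : cross3 i 0 1 := by rw [h]; trivial
  have h2 : cross3 i 0 2 := by rw [h]; trivial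
  rw [cross3_rel] at h1 h2
  fin_cases i <;> simp at h1 h2

/-- `cross3 i` is not the discrete partition. -/
theorem cross3_ne_bot (i : Fin 3) : cross3 i ≠ ⊥ := by
  intro h
  have h1 : cross3 i 0 1 ∨ cross3 i 0 2 ∨ cross3 i 1 2 := by
    simp only [cross3_rel]
    fin_cases i <;> simp
  rw [h] at h1
  rcases h1 with h1 | h1 | h1 <;> exact absurd (show (_ : Fin 3) = _ from h1) (by decide)

/-- Two distinct two-block partitions of three indices meet in the discrete partition. -/
theorem cross3_inf_eq_bot {i j : Fin 3} (h : i ≠ j) : cross3 i ⊓ cross3 j = ⊥ := by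
  refine le_antisymm ?_ bot_le
  rw [Setoid.le_def]
  intro a b hab
  have h1 : cross3 i a b := hab.1
  have h2 : cross3 j a b := hab.2
  rw [cross3_rel] at h1 h2
  show a = b
  fin_cases i <;> fin_cases j <;> (try exact absurd rfl h) <;>
    fin_cases a <;> fin_cases b <;> simp at h1 h2 ⊢

/-- A setoid on `Fin 3` relating `0` to everything is `⊤`. -/
theorem Setoid.eq_top_of_rel_zero_fin3 (s : Setoid (Fin 3)) (h1 : s 0 1) (h2 : s 0 2) : s = ⊤ := by
  refine Setoid.eq_top_iff.2 fun x y => ?_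
  have h0 : ∀ z, s 0 z := by
    intro z
    fin_cases z
    · exact s.refl 0
    · exact h1
    · exact h2
  exact s.trans (s.symm (h0 x)) (h0 y)

/-- Two distinct two-block partitions of three indices join to the one-block partition. -/
theorem cross3_sup_eq_top {i j : Fin 3} (h : i ≠ j) : cross3 i ⊔ cross3 j = ⊤ := by
  have hi : ∀ a b, cross3 i a b → (cross3 i ⊔ cross3 j) a b :=
    fun a b hab => le_sup_left (a := cross3 i) (b := cross3 j) hab
  have hj : ∀ a b, cross3 j a b → (cross3 i ⊔ cross3 j) a b :=
    fun a b hab => le_sup_right (a := cross3 i) (b := cross3 j) hab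
  have ht : ∀ a b c, (cross3 i ⊔ cross3 j) a b → (cross3 i ⊔ cross3 j) b c →
      (cross3 i ⊔ cross3 j) a c :=
    fun a b c hab hbc => (cross3 i ⊔ cross3 j).trans hab hbc
  refine Setoid.eq_top_of_rel_zero_fin3 _ ?_ ?_ <;> fin_cases i <;> fin_cases j <;>
    (try exact absurd rfl h) <;>
    first
    | (refine hi _ _ ?_; simp only [cross3_rel]; decide)
    | (refine hj _ _ ?_; simp only [cross3_rel]; decide)
    | (refine ht _ 1 _ (hi _ _ ?_) (hj _ _ ?_) <;> (simp only [cross3_rel]; decide))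
    | (refine ht _ 2 _ (hi _ _ ?_) (hj _ _ ?_) <;> (simp only [cross3_rel]; decide))
    | (refine ht _ 1 _ (hj _ _ ?_) (hi _ _ ?_) <;> (simp only [cross3_rel]; decide))
    | (refine ht _ 2 _ (hj _ _ ?_) (hi _ _ ?_) <;> (simp only [cross3_rel]; decide))

/-- The two-block partitions of three indices form a crossing family. -/
theorem cross3_isCrossingFamily : IsCrossingFamily cross3 :=
  ⟨cross3_injective, fun h => cross3_inf_eq_bot h, fun h => cross3_sup_eq_top h⟩

/-- **Lemma B at `k = 3`** (the lead's testbed, 02:53:06Z): the class form of C-004. -/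
def LemmaB3Abstract : Prop := LemmaBFamily cross3

/-- **UFL (k = 3) implies Lemma B at `k = 3`** — the same set lemma as for four indices. -/
theorem LemmaB3Abstract_of_UFL3 (h : UFL3) : LemmaB3Abstract :=
  LemmaBFamily_of_UFL cross3_isCrossingFamily h

/-! ### The two-copy sum of a family kernel -/

section TwoCopy

variable {E : Type*} [Fintype E] [DecidableEq E] {k r : ℕ}

open Classical in
/-- The two-copy sum of the kernel of a family is `2·μ(⊤)μ(⊥) − Σ_{i≠j} μ(x_i)μ(x_j)`. -/
theorem twoCopy_crossKernel_eq (p : E → ℝ) (x : Fin r → Setoid (Fin k))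
    (c : Config E → Setoid (Fin k)) :
    ∑ ω : Config E, ∑ ω' : Config E, weight p ω * weight p ω' * crossKernel x (c ω) (c ω') =
      2 * (prob p {ω | c ω = ⊤} * prob p {ω | c ω = ⊥}) -
        ∑ i : Fin r, ∑ j : Fin r, if i ≠ j then prob p {ω | c ω = x i} * prob p {ω | c ω = x j}
          else 0 := by
  have e1 : prob p {ω | c ω = ⊤} * prob p {ω | c ω = ⊥} =
      ∑ ω : Config E, ∑ ω' : Config E, weight p ω * weight p ω' *
        if c ω = ⊥ ∧ c ω' = ⊤ then 1 else 0 := by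
    rw [mul_comm, prob_mul_prob_eq]
  have e2 : prob p {ω | c ω = ⊤} * prob p {ω | c ω = ⊥} =
      ∑ ω : Config E, ∑ ω' : Config E, weight p ω * weight p ω' *
        if c ω = ⊤ ∧ c ω' = ⊥ then 1 else 0 := prob_mul_prob_eq p _ _
  have e3 : ∀ i j : Fin r, (if i ≠ j then prob p {ω | c ω = x i} * prob p {ω | c ω = x j}
      else 0) = ∑ ω : Config E, ∑ ω' : Config E, weight p ω * weight p ω' *
        if i ≠ j ∧ c ω' = x i ∧ c ω = x j then 1 else 0 := by
    intro i j
    by_cases hij : i ≠ j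
    · rw [if_pos hij, mul_comm, prob_mul_prob_eq]
      refine Finset.sum_congr rfl fun ω _ => Finset.sum_congr rfl fun ω' _ => ?_
      by_cases h1 : c ω = x j <;> by_cases h2 : c ω' = x i <;> simp [h1, h2, hij]
    · rw [if_neg hij]
      simp [hij]
  have hR : ∑ ω : Config E, ∑ ω' : Config E, weight p ω * weight p ω' * crossKernel x (c ω) (c ω')
      = (∑ ω : Config E, ∑ ω' : Config E, weight p ω * weight p ω' *
          if c ω = ⊤ ∧ c ω' = ⊥ then 1 else 0) +
        (∑ ω : Config E, ∑ ω' : Config E, weight p ω * weight p ω' *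
          if c ω = ⊥ ∧ c ω' = ⊤ then 1 else 0) -
        ∑ ω : Config E, ∑ ω' : Config E, ∑ i : Fin r, ∑ j : Fin r, weight p ω * weight p ω' *
          if i ≠ j ∧ c ω' = x i ∧ c ω = x j then 1 else 0 := by
    simp only [crossKernel, mul_add, mul_sub, Finset.mul_sum, Finset.sum_add_distrib,
      Finset.sum_sub_distrib]
  rw [hR, ← sum_comm4]
  simp only [e3]
  rw [← e1, ← e2]
  ring

end TwoCopy

/-! ### The abstract C-004 and the chain from Lemma B at `k = 3` -/

/-- **The abstract C-004**: for every product measure on a cube and every monotone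
`c : Config E → Setoid (Fin 3)`, `2·μ(⊤)μ(⊥) ≥ Σ_{i≠j} μ(x_i)μ(x_j)` — the pair-sum inequality
with the marked partition replaced by any monotone map into the partitions of three indices. -/
def C004abstract : Prop :=
  ∀ {E : Type} [Fintype E] [DecidableEq E] (p : E → ℝ), IsProb p →
    ∀ c : Config E → Setoid (Fin 3), Monotone c →
      ∑ i : Fin 3, ∑ j : Fin 3, (if i ≠ j then prob p {ω | c ω = cross3 i} * prob p {ω | c ω = cross3 j}
        else 0) ≤ 2 * (prob p {ω | c ω = ⊤} * prob p {ω | c ω = ⊥})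

open Classical in
/-- **Lemma B at `k = 3` implies the abstract C-004** (group by join and meet, every face term is
nonnegative). -/
theorem C004abstract_of_LemmaB3Abstract (hB : LemmaB3Abstract) : C004abstract := by
  intro E _ _ p hp c hc
  have h := twoCopy_crossKernel_eq p cross3 c
  rw [twoCopy_eq_sum_faces p c (crossKernel cross3)] at h
  have hnn : 0 ≤ ∑ uv : Config E × Config E, weight p uv.2 * weight p uv.1 *
      if uv.2 ≤ uv.1 then ∑ ρ : Config (Face uv.1 uv.2),
        crossKernel cross3 (c (embed uv.1 uv.2 ρ)) (c (embed uv.1 uv.2 ρᶜ)) else 0 := by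
    refine Finset.sum_nonneg fun uv _ => ?_
    refine mul_nonneg (mul_nonneg (weight_nonneg hp _) (weight_nonneg hp _)) ?_
    split_ifs with hle
    · exact sum_crossKernel_compl_nonneg cross3_injective hB (fun ρ => c (embed uv.1 uv.2 ρ))
        (hc.comp (embed_mono uv.1 uv.2))
    · exact le_rfl
  linarith

/-- The kernel of the constant labels `000` is the one-block partition of three indices. -/
theorem Setoid.ker_rgs3_top : Setoid.ker (![0, 0, 0] : Fin 3 → ℕ) = ⊤ :=
  Setoid.ext fun a b => by
    rw [Setoid.ker_def]
    exact ⟨fun _ => trivial, fun _ => by fin_cases a <;> fin_cases b <;> rfl⟩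

/-- The kernel of the injective labels `012` is the discrete partition of three indices. -/
theorem Setoid.ker_rgs3_bot : Setoid.ker (![0, 1, 2] : Fin 3 → ℕ) = ⊥ :=
  Setoid.ext fun a b => by
    rw [Setoid.ker_def]
    constructor
    · intro h
      fin_cases a <;> fin_cases b <;> simp_all
    · rintro rfl
      rfl

namespace MultiGraph

variable {V E : Type*} (G : MultiGraph V E) [Fintype E] [DecidableEq E]

/-- **The abstract C-004 implies C-004**: the marked partition of `a, b, c` is a monotone map and
its cells are the engine rows. -/
theorem C004_of_C004abstract (h : C004abstract) : C004 := by
  intro V E _ _ G p hp a b c _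
  have key := h p hp (fun ω => G.markedPartition ω ![a, b, c]) (G.markedPartition_mono _)
  have hT : {ω : Config E | G.markedPartition ω ![a, b, c] = ⊤} =
      G.partitionEvent ![a, b, c] ![0, 0, 0] := by
    rw [G.partitionEvent_eq_partitionSetoidEvent, Setoid.ker_rgs3_top]
    rfl
  have hB : {ω : Config E | G.markedPartition ω ![a, b, c] = ⊥} =
      G.partitionEvent ![a, b, c] ![0, 1, 2] := by
    rw [G.partitionEvent_eq_partitionSetoidEvent, Setoid.ker_rgs3_bot]
    rfl
  have hx : ∀ i : Fin 3, {ω : Config E | G.markedPartition ω ![a, b, c] = cross3 i} =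
      G.partitionEvent ![a, b, c] (![![0, 0, 1], ![0, 1, 0], ![0, 1, 1]] i) := by
    intro i
    rw [G.partitionEvent_eq_partitionSetoidEvent]
    fin_cases i <;> rfl
  simp only [hT, hB, hx, Fin.sum_univ_succ, Fin.sum_univ_zero] at key
  simp at key
  linarith

end MultiGraph

/-- **Lemma B at `k = 3` implies C-004** — the classwise route to Gladkov's Cor 4.2. -/
theorem C004_of_LemmaB3Abstract (hB : LemmaB3Abstract) : C004 :=
  MultiGraph.C004_of_C004abstract (C004abstract_of_LemmaB3Abstract hB)

/-- **UFL (k = 3) implies C-004.** -/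
theorem C004_of_UFL3 (h : UFL3) : C004 := C004_of_LemmaB3Abstract (LemmaB3Abstract_of_UFL3 h)

/-- **MS3 implies C-005** (through the abstract Lemma B). -/
theorem C005_of_MS3 (h : MS3) : C005 := C005_of_LemmaBAbstract (LemmaBAbstract_of_MS3 h)

/-- **MS3 implies C-004** (through Lemma B at `k = 3`). -/
theorem C004_of_MS3 (h : MS3) : C004 :=
  C004_of_LemmaB3Abstract (LemmaBFamily_of_MSr cross3 cross3_isCrossingFamily h)

end PercRepro
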